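import Literature.MathematicalPhysics.QuantumFieldTheory.Balaban1983to89.B9Eq384RemainderLetters
import Literature.MathematicalPhysics.QuantumFieldTheory.Balaban1983to89.B9Eq373V3
import Literature.Analysis.Complex.RungeUnits

/-!
# `Balaban1983to89.B9Eq373TransporterLipschitzLetters` — T. Bałaban, *Propagators for lattice gauge theories in a background field*, Commun. Math. Phys.
# **99** (1985) 389–434 [Balaban1985BackgroundPropagators] (3.70) p. 404 (*«R(U′(x,x′)) = exp(ηi ad A(x,x′))»* and its expansion), (3.73) p. 405
# (*«|(V₁(A)A′)(b)| ≤ O(1)(|∇A||A′| + |A||∇A′| + |A|²|A′|)»* — the remainder is FIRST ORDER IN THE COVARIANT DERIVATIVE `∇A` of the gauge field),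
# (3.35) p. 396 (the regularity gauge: `U = e^{iηA}`, `|A| < O(1)Mα₀(Lʲη)⁻¹`, `|∇^ηA| < O(1)Mα₀(Lʲη)⁻²`): **THE TRANSPORTERS ARE LIPSCHITZ IN THE BOND
# VARIABLE — `‖R(u)w − R(v)w‖ ≤ 2M_φM_φ′·‖u − v‖·‖w‖` and `‖R(u⁻¹)w − R(v⁻¹)w‖ ≤ 2M_φM_φ′·‖u − v‖·‖w‖` for unit-bounded `u, v`, and
# `‖e^{iηA} − e^{iηA′}‖ ≤ η·‖A − A′‖·e^{η·r}` for `‖A‖, ‖A′‖ ≤ r` — so that the DIFFERENCE OF TWO CONSECUTIVE TRANSPORTERS `R(U(x,μ)) − R(U(x−e_μ,μ))` of a field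
# in the gauge (3.35) is `O(η²|∇^ηA|)` on the fibre: the `|∇_U B|` letter `b′` of the paired two-background remainder `B9Eq373KatoPairedRemainder` through
# `B9Eq331PureGaugeResolventConjugation` §6 (`hdV`∕`hdV′`), and the two-field letter `‖R(U(b)) − R(U′(b))‖ = O(‖U(b) − U′(b)‖)` of the two-background
# files (`hRR′`∕`hSS′`)**

statement-level skeleton of published theorems with citation tags; proofs where landed; nothing here is a claim about the Yang–Mills mass gap

CITATION HEADER (lean-in-tree rule).  Audit cell `pub-balaban`, sub-cell `t4`, BINDER row NE9; filed by NE9 crux-team LEAF PROVER 05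
(`b2b-balaban-t4-ne9-formalise-leaf-05`, gen 83).  SOURCE READ first-hand in the held text layer [Balaban1985BackgroundPropagators]
(`paper:balaban1985-cmp99-background-propagators`, journal page = PDF page + 388): p. 404 (3.70) *«R(U′(x,x′)) = exp(ηi ad A(x,x′)) = 1 + Σ_{n≥1} (1∕n!)(ηi ad
A(x,x′))ⁿ»*; p. 405 (3.73) and *«The derivatives are, of course, the covariant derivatives defined by U. The constant O(1) is an absolute constant depending on d
only»*; p. 396 (3.35).  The lemmas are [folklore] (resolvent-type identities `uXu⁻¹ − vXv⁻¹ = (u − v)Xv⁻¹ + uX(u⁻¹ − v⁻¹)`, `u⁻¹ − v⁻¹ = u⁻¹(v − u)v⁻¹`, and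
the local Lipschitz bound of `exp` in a Banach algebra, `Literature.Analysis.Complex.norm_exp_sub_exp_le`); nothing printed is a hypothesis.  The
ALGEBRA-level twin `‖R(V)X − R(V′)X‖ ≤ 2δ‖X‖` is the tree's `B9Eq39TwoBackgroundLetters.norm_R_sub_R_le` (pv27 carrier `B9Eq39Adjoint.R`, outside this
file's import cone); §1 is its reading on the chain's Hilbert fibre `W` through `φ` (`B9Eq310HessianOperator.adTransportW`), where the consumers live.

WHY THIS FILE (cell context).  Storey J of the NE9 chain (the covariant-gradient row of [B9] (3.42); OWNER t4-ne9-p1 plan v11 §2 (ii), t4-ne9-idea-1 gens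
111–141) sizes the two-background perturbation `(Δ_U − Δ_{U⁰})(χu)` by the PAIRED remainder `B9Eq373KatoPairedRemainder.norm_equiv_covLaplaceSiteK_sub_le_paired`,
whose zeroth order `η⁻²(b′ + b²)` is `η`-free only if the covariant-difference letter `b′` is `O(η²)`.  `B9Eq331PureGaugeResolventConjugation` §6 reduces `b′`
for the pair `(1^g, V^g)` to the fibre size of `R(V(x,μ)^{∓1}) − R(V(x−e_μ,μ)^{∓1})`; THIS file reduces that to the group-level difference `‖V(x,μ) − V(x−e_μ,μ)‖`
(§1) and the latter, for `V = e^{iηA}`, to `η·‖A(x,μ) − A(x−e_μ,μ)‖ = η²·|∇^η_μA_μ|` (§2) — print's (3.73) mechanism.  The companion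
`B9Eq384RemainderLetters.norm_adTransportW_sub_le` (`‖R(U(b))w − w‖ ≤ 2M_φM_φ′·‖U(b) − 1‖·‖w‖`) is the `v = 1` case of §1.

WHAT IS PROVED (sorry-free; 0 `def`; [folklore]).  `𝔸` a normed `ℂ`-algebra with `‖1‖ = 1`, `U1 𝔸` the unit-bounded units (`‖u‖, ‖u⁻¹‖ ≤ 1`,
`B7Prop1Explicit.U1`), fibre `W ≃ₗ 𝔸` along `φ` with `‖φw‖ ≤ M_φ‖w‖`, `‖φ⁻¹X‖ ≤ M_φ′‖X‖`, `0 ≤ M_φ′`.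
* (group level) the tree's `B9Eq373V3.norm_units_inv_sub_inv_le` (`‖u⁻¹ − v⁻¹‖ ≤ r′r‖u − v‖`), used at `r′ = r = 1` — not re-declared.
* §1 **`norm_adTransportW_sub_adTransportW_le`** — for transporter fields `U, U′` and bonds `b, b′` with `U(b), U′(b′) ∈ U1`:
  `‖R(U(b))w − R(U′(b′))w‖ ≤ 2M_φM_φ′·‖U(b) − U′(b′)‖·‖w‖` (one field at two bonds: the `hdV` of `B9Eq331PureGaugeResolventConjugation.norm_covDiff_relTransporter_gaugeU_le`;
  two fields at one bond: the `hRR′` of `B9Eq373DerivativeRemainderTwoBackgrounds`); **`norm_adTransportW_inv_sub_adTransportW_inv_le`** — the same bound for the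
  adjoint transporters `R(U(b)⁻¹)`, `R(U′(b′)⁻¹)` (the `hdV′` of `…norm_covDiff_relTransporter_pureGauge_le`; the `hSS′`).
* §2 (`𝔸` complete) **`norm_exp_sub_exp_le_of_norm_le`** — `‖X‖, ‖Y‖ ≤ r ⟹ ‖e^X − e^Y‖ ≤ ‖X − Y‖·e^r`; **`norm_exp_smul_sub_exp_smul_le`** — for real `η ≥ 0` and
  `‖A‖, ‖A′‖ ≤ r`: `‖e^{iηA} − e^{iηA′}‖ ≤ η·‖A − A′‖·e^{η·r}` (so `‖A(x,μ) − A(x−e_μ,μ)‖ ≤ η·a′` — the flat gradient bound of (3.35), `a′ = O(1)Mα₀(Lʲη)⁻²` —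
  gives `‖U(x,μ) − U(x−e_μ,μ)‖ ≤ η²·a′·e^{ηr}`, and §1 then `b′ = 2M_φM_φ′·η²·a′·e^{ηr}`).
HONEST SCOPE.  [folklore] inequalities; the (3.35) bounds are the CONSUMER's hypotheses (print's Thm 3.1 assumes the class (3.35); the tree's per-cube
reduction `B9Eq387CubeReductionGaugeBackground.exists_gauge_background_letters` supplies `‖Ũ(b) − 1‖ ≤ l1(n)·δ` and `‖Ũ(b) − Ũ(b′)‖ ≤ 2·l1(n)·δ` from small
plaquettes — ONE power of `η` short of (3.35)'s gradient bound, which is NOT derived here or anywhere in the tree); no lattice sum, no operator; nothing of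
Bałaban's asserted.  NOT summit progress (cell pub-balaban: NE9 NOT PRINTED ∕ NOT PROVED; «NE9 ⇐ the named binders»; row WALLED ON A MODEL (O-NE9-1; #5 UNRULED);
spine PROVED 0∕9; rung (B)+1 finite T⁴ — NOT infinite volume, NOT mass gap, NOT BetaPertH, NOT Clay).  HONEST DEPENDENCY (cell line): continuum YM on T⁴ ⇐ BetaPertH ∧
nine spine estimates (0/9 proved); BetaPertH ⇐ (D1) ∧ (D4) ∧ CAP+tail; G-an2-4 gates asym, D1 and NE2/3/4.  NEW file importing `B9Eq384RemainderLetters` and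
`B9Eq373V3` and `Literature.Analysis.Complex.RungeUnits` (all built); nothing modified.  Net new unproved facts: 0.
-/

noncomputable section

namespace Literature.MathematicalPhysics.QuantumFieldTheory.Balaban1983to89.B9Eq373TransporterLipschitzLetters

open B9SectCLatticeCarrier (Bond)
open B9Eq310HessianOperator (adTransportW adTransportW_apply)
open B7Prop1Explicit (U1 mem_U1)
open B9Eq373V3 (norm_units_inv_sub_inv_le)

/-! ## §1 Fibre level: `R(u)` and `R(u⁻¹)` are Lipschitz in `u ∈ U1` with constant `2M_φM_φ′` -/

section Fibre

variable {d : ℕ} {Pd : Fin d → ℕ} {𝔸 : Type*} [NormedRing 𝔸] [NormedAlgebra ℂ 𝔸] [NormOneClass 𝔸]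
  {W : Type*} [NormedAddCommGroup W] [InnerProductSpace ℂ W] (φ : W ≃ₗ[ℂ] 𝔸) {Mφ Mφ' : ℝ}
  (hφ : ∀ w, ‖φ w‖ ≤ Mφ * ‖w‖) (hφ' : ∀ X, ‖φ.symm X‖ ≤ Mφ' * ‖X‖) (hMφ' : 0 ≤ Mφ')

omit [NormOneClass 𝔸] in
include hφ hφ' hMφ' in
/-- the resolvent-type estimate behind §1: `‖φ⁻¹(uXu′ − vXv′)‖ ≤ 2M_φM_φ′·δ·‖w‖` for `X = φw`, `‖u‖, ‖v′‖ ≤ 1`, `‖u − v‖, ‖u′ − v′‖ ≤ δ`. [folklore] -/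
private theorem norm_symm_conj_sub_conj_le {u u' v v' : 𝔸} (hu : ‖u‖ ≤ 1) (hv' : ‖v'‖ ≤ 1) {δ : ℝ} (h₁ : ‖u - v‖ ≤ δ) (h₂ : ‖u' - v'‖ ≤ δ)
    (w : W) : ‖φ.symm (u * φ w * u' - v * φ w * v')‖ ≤ 2 * Mφ * Mφ' * δ * ‖w‖ := by
  have hδ : 0 ≤ δ := (norm_nonneg _).trans h₁
  have hX : ‖φ w‖ ≤ Mφ * ‖w‖ := hφ w
  have hMφw : 0 ≤ Mφ * ‖w‖ := (norm_nonneg _).trans hX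
  have hsplit : u * φ w * u' - v * φ w * v' = (u - v) * φ w * v' + u * φ w * (u' - v') := by noncomm_ring
  rw [hsplit]
  calc ‖φ.symm ((u - v) * φ w * v' + u * φ w * (u' - v'))‖
      ≤ Mφ' * ‖(u - v) * φ w * v' + u * φ w * (u' - v')‖ := hφ' _
    _ ≤ Mφ' * (δ * (Mφ * ‖w‖) * 1 + 1 * (Mφ * ‖w‖) * δ) := by
        refine mul_le_mul_of_nonneg_left ?_ hMφ'
        refine (norm_add_le _ _).trans (add_le_add ?_ ?_)
        · exact norm_mul₃_le.trans (mul_le_mul (mul_le_mul h₁ hX (norm_nonneg _) hδ) hv' (norm_nonneg _) (by positivity))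
        · exact norm_mul₃_le.trans (mul_le_mul (mul_le_mul hu hX (norm_nonneg _) zero_le_one) h₂ (norm_nonneg _) (by positivity))
    _ = 2 * Mφ * Mφ' * δ * ‖w‖ := by ring

include hφ hφ' hMφ' in
/-- **`‖R(U(b))w − R(U′(b′))w‖ ≤ 2M_φM_φ′·‖U(b) − U′(b′)‖·‖w‖`** for transporter fields `U, U′` and bonds `b, b′` with `U(b), U′(b′) ∈ U1`:
`uXu⁻¹ − vXv⁻¹ = (u − v)Xv⁻¹ + uX(u⁻¹ − v⁻¹)` and `‖u⁻¹ − v⁻¹‖ ≤ ‖u − v‖` (`B9Eq373V3.norm_units_inv_sub_inv_le`).  One field at two consecutive bonds (`U′ = U`, `b′ = (x−e_μ,μ)`, `b = (x,μ)`): the `hdV` letter of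
`B9Eq331PureGaugeResolventConjugation.norm_covDiff_relTransporter_gaugeU_le` with `ε′ = 2M_φM_φ′·‖U(x,μ) − U(x−e_μ,μ)‖`; two fields at one bond: the `hRR′`
letter of the two-background remainders. [folklore] [cite: Balaban1985BackgroundPropagators, (3.70) p.404, (3.73) p.405] -/
theorem norm_adTransportW_sub_adTransportW_le (U U' : Bond d Pd → 𝔸ˣ) (b b' : Bond d Pd) (hb : U b ∈ U1 𝔸) (hb' : U' b' ∈ U1 𝔸) (w : W) :
    ‖adTransportW φ U b w - adTransportW φ U' b' w‖ ≤ 2 * Mφ * Mφ' * ‖(U b : 𝔸) - (U' b' : 𝔸)‖ * ‖w‖ := by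
  have hinv : ‖(((U b)⁻¹ : 𝔸ˣ) : 𝔸) - (((U' b')⁻¹ : 𝔸ˣ) : 𝔸)‖ ≤ ‖(U b : 𝔸) - (U' b' : 𝔸)‖ := by
    simpa only [one_mul] using norm_units_inv_sub_inv_le (mem_U1.1 hb).2 (mem_U1.1 hb').2
  rw [adTransportW_apply, adTransportW_apply, ← map_sub]
  exact norm_symm_conj_sub_conj_le φ hφ hφ' hMφ' (mem_U1.1 hb).1 (mem_U1.1 hb').2 le_rfl hinv w

include hφ hφ' hMφ' in
/-- **`‖R(U(b)⁻¹)w − R(U′(b′)⁻¹)w‖ ≤ 2M_φM_φ′·‖U(b) − U′(b′)‖·‖w‖`** — the same for the ADJOINT transporters (the `hdV′` letter of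
`B9Eq331PureGaugeResolventConjugation.norm_covDiff_relTransporter_pureGauge_le`; the `hSS′` letter of the two-background remainders). [folklore]
[cite: Balaban1985BackgroundPropagators, (3.70) p.404, (3.73) p.405, (3.8) p.392] -/
theorem norm_adTransportW_inv_sub_adTransportW_inv_le (U U' : Bond d Pd → 𝔸ˣ) (b b' : Bond d Pd) (hb : U b ∈ U1 𝔸) (hb' : U' b' ∈ U1 𝔸) (w : W) :
    ‖adTransportW φ (fun b => (U b)⁻¹) b w - adTransportW φ (fun b => (U' b)⁻¹) b' w‖ ≤ 2 * Mφ * Mφ' * ‖(U b : 𝔸) - (U' b' : 𝔸)‖ * ‖w‖ := by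
  have hinv : ‖(((U b)⁻¹ : 𝔸ˣ) : 𝔸) - (((U' b')⁻¹ : 𝔸ˣ) : 𝔸)‖ ≤ ‖(U b : 𝔸) - (U' b' : 𝔸)‖ := by
    simpa only [one_mul] using norm_units_inv_sub_inv_le (mem_U1.1 hb).2 (mem_U1.1 hb').2
  rw [adTransportW_apply, adTransportW_apply, ← map_sub, inv_inv, inv_inv]
  exact norm_symm_conj_sub_conj_le φ hφ hφ' hMφ' (mem_U1.1 hb).2 (mem_U1.1 hb').1 hinv le_rfl w

end Fibre

/-! ## §2 The exponential reading: `‖e^{iηA} − e^{iηA′}‖ ≤ η·‖A − A′‖·e^{η·r}` for `‖A‖, ‖A′‖ ≤ r` (from `e^{max(‖X‖,‖Y‖)} ≤ e^{ηr}`) -/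

section Exp

open NormedSpace

variable {𝔸 : Type*} [NormedRing 𝔸] [NormedAlgebra ℂ 𝔸] [CompleteSpace 𝔸] [NormOneClass 𝔸]

/-- **`‖X‖, ‖Y‖ ≤ r ⟹ ‖e^X − e^Y‖ ≤ ‖X − Y‖·e^r`** (`Literature.Analysis.Complex.norm_exp_sub_exp_le` with the maximum bounded). [folklore]
[cite: Balaban1985BackgroundPropagators, (3.70) p.404] -/
theorem norm_exp_sub_exp_le_of_norm_le {X Y : 𝔸} {r : ℝ} (hX : ‖X‖ ≤ r) (hY : ‖Y‖ ≤ r) : ‖exp X - exp Y‖ ≤ ‖X - Y‖ * Real.exp r :=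
  (Literature.Analysis.Complex.norm_exp_sub_exp_le X Y).trans
    (mul_le_mul_of_nonneg_left (Real.exp_le_exp.2 (max_le hX hY)) (norm_nonneg _))

/-- **`‖e^{iηA} − e^{iηA′}‖ ≤ η·‖A − A′‖·e^{η·r}`** for real `η ≥ 0` and `‖A‖, ‖A′‖ ≤ r` — print's `U′(b) = e^{iηA(b)}` ((3.1), (3.35), (3.70)): two consecutive bond
variables of a field in the gauge (3.35) differ by `≤ η·‖A(x,μ) − A(x−e_μ,μ)‖·e^{ηr} = η²·|∇^η_μA_μ(x−e_μ)|·e^{ηr}`. [folklore]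
[cite: Balaban1985BackgroundPropagators, (3.70) p.404, (3.35) p.396, (3.73) p.405] -/
theorem norm_exp_smul_sub_exp_smul_le {η : ℝ} (hη : 0 ≤ η) {A A' : 𝔸} {r : ℝ} (hA : ‖A‖ ≤ r) (hA' : ‖A'‖ ≤ r) :
    ‖exp ((Complex.I * η : ℂ) • A) - exp ((Complex.I * η : ℂ) • A')‖ ≤ η * ‖A - A'‖ * Real.exp (η * r) := by
  have hn : ‖(Complex.I * η : ℂ)‖ = η := by rw [norm_mul, Complex.norm_I, one_mul, Complex.norm_real, Real.norm_of_nonneg hη]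
  have h1 : ‖(Complex.I * η : ℂ) • A‖ ≤ η * r := by rw [norm_smul, hn]; exact mul_le_mul_of_nonneg_left hA hη
  have h2 : ‖(Complex.I * η : ℂ) • A'‖ ≤ η * r := by rw [norm_smul, hn]; exact mul_le_mul_of_nonneg_left hA' hη
  refine (norm_exp_sub_exp_le_of_norm_le h1 h2).trans (le_of_eq ?_)
  rw [← smul_sub, norm_smul, hn]

end Exp

end Literature.MathematicalPhysics.QuantumFieldTheory.Balaban1983to89.B9Eq373TransporterLipschitzLetters

end
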